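import Mathlib.GroupTheory.Index
import Mathlib.GroupTheory.SpecificGroups.Cyclic
import Mathlib.Data.Set.Card
import Mathlib.Data.Fin.VecNotation
import Mathlib.Tactic.FinCases
import Mathlib.Tactic.Linarith
import HarnessLib

/-!
# Non-commutative subgroups of order `6` (the `S₃` relations, derived classification-free), commutativity from an
# abelian subgroup of index `2`, and the involutions of a cyclic group of order divisible by `4`

COR-CM (cell `pub-hodgecm2`), binder seat b04 (gen 14), count-neutral claim GALOIS-DODECIC, part Ia: the pure group
theory behind `CorCM/GaloisDodecicStabiliserLemma` (part Ib) and `CorCM/GaloisDodecicSimpleCMSixfolds` (part II: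
every simple CM abelian SIXFOLD whose CM field is Galois over `ℚ` with non-abelian or cyclic Galois group is
nondegenerate).  Sequel of the octic toolkit `CorCM/GaloisOcticStabiliserLemma` (gen 13).  KERNEL ONLY: theorems,
no definition, no named fact, no `sorry`.  `HC_CM` is not used and not claimed.

§1 `GaloisDodecic.exists_generators_of_card_six` — a NON-COMMUTATIVE subgroup `H` with `|H| = 6` is
   `{1, r, r², s, sr, sr²}` with `r³ = 1`, `s² = 1`, `rs = sr²` (six distinct elements): `r` is the square of a
   non-involution among two non-commuting elements `a, b` and their product (no Cauchy / Sylow), `s ∈ H ∖ {1, r, r²}`,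
   and the relations follow from `rs ∈ H`, `s² ∈ H` by excluding the other five values each (`rs = sr` would make
   `H` commutative).
§2 `GaloisDodecic.comm_of_index_two` — if a subgroup of index `2` is commutative and some central `c ∉ H` exists,
   the whole group is commutative (`G = H ⊔ cH`); contrapositive `exists_not_comm_of_index_two`.
§3 `GaloisDodecic.mem_of_isCyclic_of_four_dvd` — in a cyclic group whose order is divisible by `4`, every
   involution is a square, hence lies in every subgroup of index `2`.  (For a Galois CM field of degree `4m'` with
   cyclic group: complex conjugation fixes every quadratic subfield — no imaginary quadratic subfield.)
All statements are [folklore]-level group theory, written out because Mathlib has no classification of the groups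
of order `6` / `12` to quote; the assembly into the degree-`12` nondegeneracy theorem is NEW (part II).
-/

set_option autoImplicit false

namespace Summit.HodgeConjecture.CorCM

namespace GaloisDodecic

section Group

variable {G : Type*} [Group G]

/-! ## §1 The structure of a non-commutative subgroup of order `6` -/

/-- In a subgroup of order `6` every element satisfies `u⁶ = 1` (Lagrange). [folklore] -/
theorem pow_six_eq_one_of_mem {H : Subgroup G} (hH : Nat.card H = 6) {u : G} (hu : u ∈ H) : u ^ 6 = 1 := by
  have h : (⟨u, hu⟩ : H) ^ Nat.card H = 1 := pow_card_eq_one'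
  rw [hH] at h
  exact congrArg Subtype.val h

/-- Two involutions whose product is an involution commute. [folklore] -/
theorem mul_comm_of_involutions {a b : G} (ha : a * a = 1) (hb : b * b = 1) (hab : a * b * (a * b) = 1) :
    a * b = b * a := by
  have ha' : a⁻¹ = a := inv_eq_of_mul_eq_one_right ha
  have hb' : b⁻¹ = b := inv_eq_of_mul_eq_one_right hb
  have h : (a * b)⁻¹ = a * b := inv_eq_of_mul_eq_one_right hab
  rw [mul_inv_rev, ha', hb'] at h
  exact h.symm

/-- **A non-commutative subgroup of order `6` contains an element `r ≠ 1` with `r³ = 1`**: if `a, b ∈ H` do not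
commute, one of `a, b, ab` is not an involution, and its square `r` has `r³ = (·)⁶ = 1`, `r ≠ 1`.  (No Cauchy /
Sylow.) [folklore] -/
theorem exists_cube_eq_one {H : Subgroup G} (hH : Nat.card H = 6) (hnc : ∃ a ∈ H, ∃ b ∈ H, a * b ≠ b * a) :
    ∃ r ∈ H, r ≠ 1 ∧ r * (r * r) = 1 := by
  obtain ⟨a, ha, b, hb, hab⟩ := hnc
  -- an element `x ∈ H` with `x² ≠ 1` gives `r = x²`
  have key : ∀ x ∈ H, x * x ≠ 1 → ∃ r ∈ H, r ≠ 1 ∧ r * (r * r) = 1 := by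
    intro x hx hxx
    refine ⟨x * x, H.mul_mem hx hx, hxx, ?_⟩
    have h6 := pow_six_eq_one_of_mem hH hx
    calc x * x * (x * x * (x * x)) = x ^ 2 * (x ^ 2 * x ^ 2) := by rw [pow_two]
      _ = x ^ (2 + (2 + 2)) := by rw [← pow_add, ← pow_add]
      _ = 1 := h6
  by_cases haa : a * a = 1
  · by_cases hbb : b * b = 1
    · by_cases habab : a * b * (a * b) = 1
      · exact absurd (mul_comm_of_involutions haa hbb habab) hab
      · exact key (a * b) (H.mul_mem ha hb) habab
    · exact key b hb hbb
  · exact key a ha haa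

/-- **A non-commutative subgroup of order `6` is `{1, r, r², s, sr, sr²}` with `r³ = 1`, `s² = 1`, `rs = sr²`**
(the `S₃` presentation, obtained WITHOUT the classification of groups of order `6`): the six listed elements are
pairwise distinct, lie in `H` and exhaust it. [folklore] -/
theorem exists_generators_of_card_six {H : Subgroup G} (hH : Nat.card H = 6)
    (hnc : ∃ a ∈ H, ∃ b ∈ H, a * b ≠ b * a) :
    ∃ r s : G, r ≠ 1 ∧ r * (r * r) = 1 ∧ s * s = 1 ∧ r * s = s * (r * r) ∧
      (∀ i, (![1, r, r * r, s, s * r, s * (r * r)] : Fin 6 → G) i ∈ H) ∧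
      Function.Injective (![1, r, r * r, s, s * r, s * (r * r)] : Fin 6 → G) ∧
      ∀ h : G, h ∈ H → ∃ i, (![1, r, r * r, s, s * r, s * (r * r)] : Fin 6 → G) i = h := by
  classical
  -- (1) an element `r` of order `3`
  obtain ⟨r, hrH, hr1, hr3⟩ := exists_cube_eq_one hH hnc
  have hr3' : ∀ x : G, r * (r * (r * x)) = x := fun x => by
    rw [← mul_assoc, ← mul_assoc, mul_assoc r r r, hr3, one_mul]
  have hrinv : r⁻¹ = r * r := inv_eq_of_mul_eq_one_right hr3
  have hrr3 : r * r * r = 1 := by rw [mul_assoc, hr3]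
  have hrrinv : (r * r)⁻¹ = r := inv_eq_of_mul_eq_one_right hrr3
  have hrr1 : r * r ≠ 1 := by
    intro h
    apply hr1
    have h' := hr3
    rw [h, mul_one] at h'
    exact h'
  have hr_rr : r ≠ r * r := by
    intro h
    apply hr1
    have : r * 1 = r * r := by rw [mul_one]; exact h
    exact (mul_left_cancel this).symm
  -- (2) `H` is finite of size `6`; an element `s` of `H` off `P = {1, r, r²}`
  have hHn : (H : Set G).ncard = 6 := by rw [← hH]; exact (Nat.card_coe_set_eq (H : Set G)).symm
  have hHfin : (H : Set G).Finite := Set.finite_of_ncard_pos (by rw [hHn]; norm_num)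
  have hP3 : ({1, r, r * r} : Set G).ncard ≤ 3 := by
    refine (Set.ncard_insert_le _ _).trans ?_
    have := Set.ncard_insert_le r ({r * r} : Set G)
    rw [Set.ncard_singleton] at this
    omega
  obtain ⟨s, hsH, hsP⟩ : ∃ s, s ∈ (H : Set G) ∧ s ∉ ({1, r, r * r} : Set G) :=
    Set.exists_mem_notMem_of_ncard_lt_ncard (by rw [hHn]; omega)
  have hsH' : s ∈ H := hsH
  -- `P` is closed under `q p⁻¹`, so `s p ≠ q` for `p, q ∈ P`
  have hsne : ∀ p q : G, p ∈ ({1, r, r * r} : Set G) → q ∈ ({1, r, r * r} : Set G) → s * p ≠ q := by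
    intro p q hp hq h
    apply hsP
    have hs : s = q * p⁻¹ := by rw [← h, mul_inv_cancel_right]
    rw [hs]
    simp only [Set.mem_insert_iff, Set.mem_singleton_iff] at hp hq ⊢
    rcases hp with rfl | rfl | rfl <;> rcases hq with rfl | rfl | rfl
    · simp
    · simp
    · simp
    · right; right; rw [one_mul, hrinv]
    · left; rw [mul_inv_cancel]
    · right; left; rw [mul_assoc, mul_inv_cancel, mul_one]
    · right; left; rw [one_mul, hrrinv]
    · right; right; rw [hrrinv]
    · left; rw [mul_inv_cancel]
  have h1P : (1 : G) ∈ ({1, r, r * r} : Set G) := by simp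
  have hrP : r ∈ ({1, r, r * r} : Set G) := by simp
  have hrrP : r * r ∈ ({1, r, r * r} : Set G) := by simp
  -- (3) the enumeration `e = (1, r, r², s, sr, sr²)` of `H`
  set e : Fin 6 → G := ![1, r, r * r, s, s * r, s * (r * r)] with he_def
  have he0 : e 0 = 1 := rfl
  have he1 : e 1 = r := rfl
  have he2 : e 2 = r * r := rfl
  have he3 : e 3 = s := rfl
  have he4 : e 4 = s * r := rfl
  have he5 : e 5 = s * (r * r) := rfl
  have heH : ∀ i, e i ∈ H := by
    intro i
    fin_cases i
    · exact H.one_mem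
    · exact hrH
    · exact H.mul_mem hrH hrH
    · exact hsH'
    · exact H.mul_mem hsH' hrH
    · exact H.mul_mem hsH' (H.mul_mem hrH hrH)
  -- the `s`-row is pairwise distinct by left cancellation
  have hs_sr : s ≠ s * r := fun h => hr1 (mul_left_cancel (a := s) (by rw [mul_one]; exact h)).symm
  have hs_srr : s ≠ s * (r * r) := fun h => hrr1 (mul_left_cancel (a := s) (by rw [mul_one]; exact h)).symm
  have hsr_srr : s * r ≠ s * (r * r) := fun h => hr_rr (mul_left_cancel h)
  -- plain forms of the fifteen inequalities between the six listed elements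
  have hs1 : s ≠ 1 := fun h => hsP (by simp [h])
  have hsr : s ≠ r := fun h => hsP (by simp [h])
  have hsrr : s ≠ r * r := fun h => hsP (by simp [h])
  have hsr1 : s * r ≠ 1 := hsne _ _ hrP h1P
  have hsrr' : s * r ≠ r := hsne _ _ hrP hrP
  have hsrrr : s * r ≠ r * r := hsne _ _ hrP hrrP
  have hsrr1 : s * (r * r) ≠ 1 := hsne _ _ hrrP h1P
  have hsrrr' : s * (r * r) ≠ r := hsne _ _ hrrP hrP
  have hsrrrr : s * (r * r) ≠ r * r := hsne _ _ hrrP hrrP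
  have hinj : Function.Injective e := by
    intro i j hij
    fin_cases i <;> fin_cases j <;>
      first
      | rfl
      | (exfalso
         first
         | exact hr1 hij
         | exact hr1 hij.symm
         | exact hrr1 hij
         | exact hrr1 hij.symm
         | exact hr_rr hij
         | exact hr_rr hij.symm
         | exact hs1 hij
         | exact hs1 hij.symm
         | exact hsr hij
         | exact hsr hij.symm
         | exact hsrr hij
         | exact hsrr hij.symm
         | exact hsr1 hij
         | exact hsr1 hij.symm
         | exact hsrr' hij
         | exact hsrr' hij.symm
         | exact hsrrr hij
         | exact hsrrr hij.symm
         | exact hsrr1 hij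
         | exact hsrr1 hij.symm
         | exact hsrrr' hij
         | exact hsrrr' hij.symm
         | exact hsrrrr hij
         | exact hsrrrr hij.symm
         | exact hs_sr hij
         | exact hs_sr hij.symm
         | exact hs_srr hij
         | exact hs_srr hij.symm
         | exact hsr_srr hij
         | exact hsr_srr hij.symm)
  -- `H = {e 0, …, e 5}`
  have hrange : Set.range e = (H : Set G) := by
    refine Set.eq_of_subset_of_ncard_le (Set.range_subset_iff.2 fun i => heH i) ?_ hHfin
    rw [hHn, ← Set.image_univ, Set.ncard_image_of_injective _ hinj, Set.ncard_univ, Nat.card_eq_fintype_card,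
      Fintype.card_fin]
  have hcover : ∀ h : G, h ∈ H → ∃ i, e i = h := fun h hh => by
    have : h ∈ Set.range e := by rw [hrange]; exact hh
    exact this
  -- (4) the relation `r s = s r²`: `r s ∈ H` is one of the six; five are impossible, `r s = s r` would make `H`
  -- commutative
  have hrs : r * s = s * (r * r) := by
    obtain ⟨i, hi⟩ := hcover (r * s) (H.mul_mem hrH hsH')
    fin_cases i
    · -- `r s = 1`: `s = r⁻¹ = r²`
      exfalso
      have hi' : r * s = 1 := hi.symm
      have : r⁻¹ = s := inv_eq_of_mul_eq_one_right hi'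
      rw [hrinv] at this
      exact hsrr this.symm
    · -- `r s = r`: `s = 1`
      exfalso
      have hi' : r * s = r * 1 := by rw [mul_one]; exact hi.symm
      exact hs1 (mul_left_cancel hi')
    · -- `r s = r r`: `s = r`
      exfalso
      have hi' : r * s = r * r := hi.symm
      exact hsr (mul_left_cancel hi')
    · -- `r s = s`: `r = 1`
      exfalso
      have hi' : r * s = 1 * s := by rw [one_mul]; exact hi.symm
      exact hr1 (mul_right_cancel hi')
    · -- `r s = s r`: then `H` would be commutative
      exfalso
      have hc4 : Commute r s := (hi.symm : r * s = s * r)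
      have hcr : ∀ j, Commute r (e j) := by
        intro j
        fin_cases j
        · exact Commute.one_right r
        · exact Commute.refl r
        · exact (Commute.refl r).mul_right (Commute.refl r)
        · exact hc4
        · exact hc4.mul_right (Commute.refl r)
        · exact hc4.mul_right ((Commute.refl r).mul_right (Commute.refl r))
      have hcs : ∀ j, Commute s (e j) := by
        intro j
        fin_cases j
        · exact Commute.one_right s
        · exact hc4.symm
        · exact hc4.symm.mul_right hc4.symm
        · exact Commute.refl s
        · exact (Commute.refl s).mul_right hc4.symm
        · exact (Commute.refl s).mul_right (hc4.symm.mul_right hc4.symm)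
      have hcall : ∀ i j, Commute (e i) (e j) := by
        intro i j
        fin_cases i
        · exact Commute.one_left _
        · exact hcr j
        · exact (hcr j).mul_left (hcr j)
        · exact hcs j
        · exact (hcs j).mul_left (hcr j)
        · exact (hcs j).mul_left ((hcr j).mul_left (hcr j))
      obtain ⟨a, ha, b, hb, hab⟩ := hnc
      obtain ⟨i, rfl⟩ := hcover a ha
      obtain ⟨j, rfl⟩ := hcover b hb
      exact hab (hcall i j)
    · exact (hi.symm : r * s = s * (r * r))
  have hrs' : ∀ x : G, r * (s * x) = s * (r * (r * x)) := fun x => by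
    rw [← mul_assoc, hrs, mul_assoc, mul_assoc]
  -- (5) the relation `s² = 1`
  have hss : s * s = 1 := by
    obtain ⟨i, hi⟩ := hcover (s * s) (H.mul_mem hsH' hsH')
    fin_cases i
    · exact (hi.symm : s * s = 1)
    · -- `s s = r`: then `s r = s (r r)`
      exfalso
      have hi' : s * s = r := hi.symm
      have h1 : s * r = s * (r * r) := by
        calc s * r = s * (s * s) := by rw [hi']
          _ = s * s * s := by rw [mul_assoc]
          _ = r * s := by rw [hi']
          _ = s * (r * r) := hrs
      exact hsr_srr h1
    · -- `s s = r r`: then `s r = s (r r)` again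
      exfalso
      have hi' : s * s = r * r := hi.symm
      have h1 : r * r * s = s * (r * r) := by
        calc r * r * s = s * s * s := by rw [hi']
          _ = s * (s * s) := by rw [mul_assoc]
          _ = s * (r * r) := by rw [hi']
      have h2 : r * r * s = s * r := by
        rw [mul_assoc, hrs, hrs', hr3']
      exact hsr_srr (h2.symm.trans h1)
    · exfalso
      have hi' : s * s = 1 * s := by rw [one_mul]; exact hi.symm
      exact hs1 (mul_right_cancel hi')
    · exfalso
      have hi' : s * s = s * r := hi.symm
      exact hsr (mul_left_cancel hi')
    · exfalso
      have hi' : s * s = s * (r * r) := hi.symm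
      exact hsrr (mul_left_cancel hi')
  have hss' : ∀ x : G, s * (s * x) = x := fun x => by rw [← mul_assoc, hss, one_mul]
  exact ⟨r, s, hr1, hr3, hss, hrs, heH, hinj, hcover⟩

/-! ## §2 An abelian subgroup of index `2` with a central element outside it -/

/-- **If a subgroup `H` of index `2` is commutative and some central `c` lies outside `H`, then `G` is
commutative** (`G = H ⊔ cH`).  For a Galois CM field: if `Gal(K/k)` is abelian for an imaginary quadratic subfield `k`
then `Gal(K/ℚ) = Gal(K/k) × ⟨c⟩` is abelian. [folklore] -/
theorem comm_of_index_two (H : Subgroup G) (hidx : H.index = 2) {c : G} (hc : c * c = 1) (hcH : c ∉ H)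
    (hcomm : ∀ g : G, c * g = g * c) (hH : ∀ a ∈ H, ∀ b ∈ H, a * b = b * a) (x y : G) : x * y = y * x := by
  have hoff : ∀ z : G, z ∉ H → ∃ h ∈ H, z = c * h := by
    intro z hz
    refine ⟨c * z, ?_, by rw [← mul_assoc, hc, one_mul]⟩
    rw [Subgroup.mul_mem_iff_of_index_two hidx]
    exact ⟨fun h => absurd h hcH, fun h => absurd h hz⟩
  by_cases hx : x ∈ H <;> by_cases hy : y ∈ H
  · exact hH x hx y hy
  · obtain ⟨h, hh, rfl⟩ := hoff y hy
    rw [← mul_assoc, ← hcomm x, mul_assoc, mul_assoc, hH x hx h hh]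
  · obtain ⟨h, hh, rfl⟩ := hoff x hx
    rw [mul_assoc, hH h hh y hy, ← mul_assoc, hcomm y, mul_assoc]
  · obtain ⟨h, hh, rfl⟩ := hoff x hx
    obtain ⟨h', hh', rfl⟩ := hoff y hy
    rw [mul_assoc, ← mul_assoc h c, ← hcomm h, mul_assoc, hH h hh h' hh', mul_assoc, ← mul_assoc h' c,
      ← hcomm h', mul_assoc]

/-- Contrapositive form used in part II: in a NON-commutative group, a subgroup of index `2` missing a central
element is itself non-commutative. [folklore] -/
theorem exists_not_comm_of_index_two (H : Subgroup G) (hidx : H.index = 2) {c : G} (hc : c * c = 1) (hcH : c ∉ H)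
    (hcomm : ∀ g : G, c * g = g * c) (hG : ∃ x y : G, x * y ≠ y * x) : ∃ a ∈ H, ∃ b ∈ H, a * b ≠ b * a := by
  by_contra! hH
  obtain ⟨x, y, hxy⟩ := hG
  exact hxy (comm_of_index_two H hidx hc hcH hcomm hH x y)

/-! ## §3 Cyclic groups of order divisible by `4`: involutions are squares -/

/-- **In a cyclic group of order divisible by `4`, every involution lies in every subgroup of index `2`**: with a
generator `g` of order `N = |G|`, `c = g^m` and `c² = 1` give `N ∣ 2m`, so `N/2 ∣ m`; as `N/2` is even, `m` is even
and `c = (g^{m/2})²` is a square, and squares lie in every subgroup of index `2`.  For a Galois CM field of degree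
divisible by `4` with cyclic Galois group this says: complex conjugation fixes every quadratic subfield, i.e. `K`
has no imaginary quadratic subfield. [folklore] -/
theorem mem_of_isCyclic_of_four_dvd [Finite G] [IsCyclic G] (h4 : 4 ∣ Nat.card G) {c : G} (hc : c * c = 1)
    (H : Subgroup G) (hidx : H.index = 2) : c ∈ H := by
  obtain ⟨g, hg⟩ := IsCyclic.exists_generator (α := G)
  obtain ⟨m, rfl⟩ := Subgroup.mem_zpowers_iff.1 (hg c)
  have hord : orderOf g = Nat.card G := orderOf_eq_card_of_forall_mem_zpowers hg
  obtain ⟨k, hk⟩ := h4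
  -- `g ^ (2m) = 1`, so `N ∣ 2m`
  have h2m : g ^ (2 * m) = 1 := by
    rw [two_mul, zpow_add]
    exact hc
  have hdvd : (orderOf g : ℤ) ∣ 2 * m := orderOf_dvd_iff_zpow_eq_one.2 h2m
  rw [hord, hk] at hdvd
  -- `4k ∣ 2m` gives `2k ∣ m`, so `m = 2t`
  obtain ⟨t, ht⟩ : ∃ t : ℤ, m = 2 * t := by
    obtain ⟨q, hq⟩ := hdvd
    refine ⟨k * q, ?_⟩
    push_cast at hq
    linarith
  rw [ht, two_mul, zpow_add]
  exact Subgroup.mul_self_mem_of_index_two hidx _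

end Group

end GaloisDodecic

end Summit.HodgeConjecture.CorCM
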